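import Summits.AtomisticToContinuum.Crystallization.Theorems.ExcessDecayLiouvilleSiteGeometry
import Summits.AtomisticToContinuum.Crystallization.Theorems.ExcessDecayLiouvilleLinearisation

/-!
# Route `ExcessDecayLiouville`: the linearised force equation of a near-lattice equilibrium

Step (a) of the excess-decay argument for item `ExcessDecay` (stmt-AtomisticToContinuum-9334).  Let the
finite configuration `X` be in Lennard-Jones force balance at the particle `π s` matched to a site `s` of
the ball `dist · c ≤ r` (matching `π` of `ExcessDecayLiouvilleMatching.lean`: `π s' ∈ X`,
`dist (π s') s' ≤ ε`, injective on the sites of the ball), with `ε ≤ 1/20`.  Writing every matched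
particle as `π s' = s' + u s'` (`‖u‖ ≤ ε`) and expanding each pair force to second order
(`norm_ljForce_linearisation_le`), the force balance at `π s` becomes

`F_r(s) + (L_r u)(s) + E(s) = −N(s)`,  `‖N(s)‖ ≤ 24000 ε² Σ_{s'} |s − s'|⁻⁹`,

where `F_r(s) = Σ_{s' ≠ s, site of the ball} h(|s−s'|²)(s−s')` is the truncated reference force,
`(L_r u)(s) = Σ_{s'} [h(|e|²)w + 2⟪e,w⟫h′(|e|²)e]` (`e = s − s'`, `w = u s − u s'`) the truncated
force-constant operator applied to the displacement, and `E(s)` the total force exerted on `π s` by the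
particles of `X` NOT matched to sites of the ball (the exterior; small by `ExcessDecayLiouvilleForceTail`).
This file proves exactly this (`norm_linearised_equation_le`), as a statement about finite sums with
all objects explicit (`SR` is any finite set listing exactly the sites of the ball, e.g.
`(finite_sites_dist_le hA hI c r).toFinset`; the exterior is `Rest = (X ∖ {π s}) ∖ π(SR ∖ {s})`).
All `[folklore]`; helper lemmas, nothing here closes an item.
-/

noncomputable section

namespace Summit.AtomisticToContinuum.Crystallization.Theorems.ExcessDecayLiouville

open scoped BigOperators Topology InnerProductSpace RealInnerProductSpace
open Literature.MathematicalPhysics.StatisticalMechanics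
open Summit.AtomisticToContinuum.Crystallization.Theorems.PhononStabilityNegative

section

variable {X : Set (EuclideanSpace ℝ (Fin 3))} {c : EuclideanSpace ℝ (Fin 3)} {r ε : ℝ}
  {t : Fin 2 → EuclideanSpace ℝ (Fin 3)} {A : EuclideanSpace ℝ (Fin 3) →L[ℝ] EuclideanSpace ℝ (Fin 3)}
  {π : EuclideanSpace ℝ (Fin 3) → EuclideanSpace ℝ (Fin 3)}

/-- Force balance at a point of a FINITE configuration, from the route's `HasSum` form to a `Finset` sum
over the other points. [folklore] -/
theorem sum_erase_eq_zero_of_hasSum (hX : X.Finite) {p : EuclideanSpace ℝ (Fin 3)}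
    (hEq : HasSum (fun q : {q : EuclideanSpace ℝ (Fin 3) // q ∈ X ∧ q ≠ p} =>
      (deriv lennardJones (dist p q) / dist p q) • (p - (q : EuclideanSpace ℝ (Fin 3)))) 0) :
    ∑ q ∈ hX.toFinset.erase p, (deriv lennardJones (dist p q) / dist p q) • (p - q) = 0 := by
  classical
  haveI : Fintype {q : EuclideanSpace ℝ (Fin 3) // q ∈ X ∧ q ≠ p} :=
    Fintype.subtype (hX.toFinset.erase p) (fun q => by
      rw [Finset.mem_erase, Set.Finite.mem_toFinset]; tauto)
  have h1 := (hasSum_fintype (fun q : {q : EuclideanSpace ℝ (Fin 3) // q ∈ X ∧ q ≠ p} =>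
      (deriv lennardJones (dist p q) / dist p q) • (p - (q : EuclideanSpace ℝ (Fin 3))))).unique hEq
  rw [← h1]
  exact Finset.sum_subtype (hX.toFinset.erase p)
    (fun q => by rw [Finset.mem_erase, Set.Finite.mem_toFinset]; tauto)
    (fun q => (deriv lennardJones (dist p q) / dist p q) • (p - q))

/-- **The linearised force equation with controlled remainder.**  See the module docstring: at a matched
particle `π s` in force balance, truncated reference force + truncated force-constant operator applied to
the displacement + exterior force add up to (minus) the nonlinear remainder, which is bounded by
`6000 (2ε)² Σ_{s'} |s − s'|⁻⁹` (`ε ≤ 1/20`; sites are `≥ 23/25 ≥ 9/10` apart). [folklore] -/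
theorem norm_linearised_equation_le (hA : Adm₀ A) (hI : Inner₀ t A) (hX : X.Finite)
    (hπ : ∀ s' ∈ Sites₀ t A, dist s' c ≤ r → π s' ∈ X ∧ dist (π s') s' ≤ ε)
    (hinj : ∀ s₁ ∈ Sites₀ t A, ∀ s₂ ∈ Sites₀ t A, dist s₁ c ≤ r → dist s₂ c ≤ r → π s₁ = π s₂ → s₁ = s₂)
    (hε : ε ≤ 1 / 20) {s : EuclideanSpace ℝ (Fin 3)} (hs : s ∈ Sites₀ t A) (hsc : dist s c ≤ r)
    (SR : Finset (EuclideanSpace ℝ (Fin 3))) (hSR : ∀ x, x ∈ SR ↔ x ∈ Sites₀ t A ∧ dist x c ≤ r)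
    (hEq : HasSum (fun q : {q : EuclideanSpace ℝ (Fin 3) // q ∈ X ∧ q ≠ π s} =>
      (deriv lennardJones (dist (π s) q) / dist (π s) q) • (π s - (q : EuclideanSpace ℝ (Fin 3)))) 0) :
    ‖(∑ s' ∈ SR.erase s, (-((‖s - s'‖ ^ 2)⁻¹) ^ 7 + ((‖s - s'‖ ^ 2)⁻¹) ^ 4) • (s - s')) +
        (∑ s' ∈ SR.erase s,
          ((-((‖s - s'‖ ^ 2)⁻¹) ^ 7 + ((‖s - s'‖ ^ 2)⁻¹) ^ 4) • ((π s - s) - (π s' - s')) +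
            (2 * ⟪s - s', (π s - s) - (π s' - s')⟫ *
              (7 * ((‖s - s'‖ ^ 2)⁻¹) ^ 8 - 4 * ((‖s - s'‖ ^ 2)⁻¹) ^ 5)) • (s - s'))) +
        ∑ q ∈ (hX.toFinset.erase (π s)) \ ((SR.erase s).image π),
          (deriv lennardJones (dist (π s) q) / dist (π s) q) • (π s - q)‖ ≤
      6000 * (2 * ε) ^ 2 * ∑ s' ∈ SR.erase s, (‖s - s'‖⁻¹) ^ 9 := by
  classical
  set Rest := (hX.toFinset.erase (π s)) \ ((SR.erase s).image π) with hRest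
  have hε0 : 0 ≤ ε := by
    have := (hπ s hs hsc).2
    exact le_trans dist_nonneg this
  -- displacement bound
  have hu : ∀ s' ∈ SR, ‖π s' - s'‖ ≤ ε := fun s' hs' => by
    rw [← dist_eq_norm]; exact (hπ s' ((hSR s').1 hs').1 ((hSR s').1 hs').2).2
  have hsSR : s ∈ SR := (hSR s).2 ⟨hs, hsc⟩
  -- the image of the punctured ball under π sits inside X \ {π s}
  have hsub : (SR.erase s).image π ⊆ hX.toFinset.erase (π s) := by
    intro q hq
    rw [Finset.mem_image] at hq
    obtain ⟨s', hs', rfl⟩ := hq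
    rw [Finset.mem_erase] at hs' ⊢
    obtain ⟨hne, hs'SR⟩ := hs'
    obtain ⟨hs'S, hs'c⟩ := (hSR s').1 hs'SR
    refine ⟨fun h => hne (hinj s' hs'S s hs hs'c hsc h), ?_⟩
    rw [Set.Finite.mem_toFinset]
    exact (hπ s' hs'S hs'c).1
  have hinjOn : Set.InjOn π (SR.erase s : Finset (EuclideanSpace ℝ (Fin 3))) := by
    intro s₁ hs₁ s₂ hs₂ h
    have h1 := (hSR s₁).1 (Finset.mem_erase.1 hs₁).2
    have h2 := (hSR s₂).1 (Finset.mem_erase.1 hs₂).2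
    exact hinj s₁ h1.1 s₂ h2.1 h1.2 h2.2 h
  -- force balance as a Finset identity, split into matched part + Rest
  have hbal := sum_erase_eq_zero_of_hasSum hX hEq
  have hsplit := Finset.sum_sdiff hsub
    (f := fun q => (deriv lennardJones (dist (π s) q) / dist (π s) q) • (π s - q))
  rw [hbal, Finset.sum_image hinjOn] at hsplit
  -- hsplit : ∑ Rest + ∑_{s' ∈ SR.erase s} f (π s) (π s') = 0
  -- expand each matched term
  have hterm : ∀ s' ∈ SR.erase s,
      (deriv lennardJones (dist (π s) (π s')) / dist (π s) (π s')) • (π s - π s') =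
        (-((‖(s - s') + ((π s - s) - (π s' - s'))‖ ^ 2)⁻¹) ^ 7 +
          ((‖(s - s') + ((π s - s) - (π s' - s'))‖ ^ 2)⁻¹) ^ 4) • ((s - s') + ((π s - s) - (π s' - s'))) := by
    intro s' hs'
    obtain ⟨hne, hs'SR⟩ := Finset.mem_erase.1 hs'
    obtain ⟨hs'S, hs'c⟩ := (hSR s').1 hs'SR
    have hpp : π s ≠ π s' := fun h => hne (hinj s' hs'S s hs hs'c hsc h.symm)
    have hvec : π s - π s' = (s - s') + ((π s - s) - (π s' - s')) := by abel
    rw [dist_eq_norm, ljForce_eq_smul (sub_ne_zero.2 hpp), hvec]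
  -- the remainder bound termwise
  have hrem : ∀ s' ∈ SR.erase s,
      ‖(-((‖(s - s') + ((π s - s) - (π s' - s'))‖ ^ 2)⁻¹) ^ 7 +
          ((‖(s - s') + ((π s - s) - (π s' - s'))‖ ^ 2)⁻¹) ^ 4) • ((s - s') + ((π s - s) - (π s' - s'))) -
        (-((‖s - s'‖ ^ 2)⁻¹) ^ 7 + ((‖s - s'‖ ^ 2)⁻¹) ^ 4) • (s - s') -
        ((-((‖s - s'‖ ^ 2)⁻¹) ^ 7 + ((‖s - s'‖ ^ 2)⁻¹) ^ 4) • ((π s - s) - (π s' - s')) +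
          (2 * ⟪s - s', (π s - s) - (π s' - s')⟫ *
            (7 * ((‖s - s'‖ ^ 2)⁻¹) ^ 8 - 4 * ((‖s - s'‖ ^ 2)⁻¹) ^ 5)) • (s - s'))‖ ≤
        6000 * (2 * ε) ^ 2 * (‖s - s'‖⁻¹) ^ 9 := by
    intro s' hs'
    obtain ⟨hne, hs'SR⟩ := Finset.mem_erase.1 hs'
    obtain ⟨hs'S, hs'c⟩ := (hSR s').1 hs'SR
    have he : 9 / 10 ≤ ‖s - s'‖ := by
      rw [← dist_eq_norm]
      linarith [dist_sites_ge hA hI hs hs'S (Ne.symm hne)]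
    have hw : ‖(π s - s) - (π s' - s')‖ ≤ 2 * ε := by
      calc ‖(π s - s) - (π s' - s')‖ ≤ ‖π s - s‖ + ‖π s' - s'‖ := norm_sub_le _ _
        _ ≤ ε + ε := add_le_add (hu s hsSR) (hu s' hs'SR)
        _ = 2 * ε := by ring
    have hw' : ‖(π s - s) - (π s' - s')‖ ≤ 1 / 10 := by linarith
    have h := norm_ljForce_linearisation_le he hw'
    refine h.trans ?_
    have h9 : 0 ≤ (‖s - s'‖⁻¹) ^ 9 := by positivity
    have hwn : 0 ≤ ‖(π s - s) - (π s' - s')‖ := norm_nonneg _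
    calc 6000 * (‖s - s'‖⁻¹) ^ 9 * ‖(π s - s) - (π s' - s')‖ ^ 2
        ≤ 6000 * (‖s - s'‖⁻¹) ^ 9 * (2 * ε) ^ 2 := by
          gcongr
      _ = 6000 * (2 * ε) ^ 2 * (‖s - s'‖⁻¹) ^ 9 := by ring
  -- assemble: the quantity to bound equals −Σ remainders
  have hkey : (∑ s' ∈ SR.erase s, (-((‖s - s'‖ ^ 2)⁻¹) ^ 7 + ((‖s - s'‖ ^ 2)⁻¹) ^ 4) • (s - s')) +
      (∑ s' ∈ SR.erase s,
        ((-((‖s - s'‖ ^ 2)⁻¹) ^ 7 + ((‖s - s'‖ ^ 2)⁻¹) ^ 4) • ((π s - s) - (π s' - s')) +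
          (2 * ⟪s - s', (π s - s) - (π s' - s')⟫ *
            (7 * ((‖s - s'‖ ^ 2)⁻¹) ^ 8 - 4 * ((‖s - s'‖ ^ 2)⁻¹) ^ 5)) • (s - s'))) +
      ∑ q ∈ Rest, (deriv lennardJones (dist (π s) q) / dist (π s) q) • (π s - q) =
      -∑ s' ∈ SR.erase s,
        ((-((‖(s - s') + ((π s - s) - (π s' - s'))‖ ^ 2)⁻¹) ^ 7 +
            ((‖(s - s') + ((π s - s) - (π s' - s'))‖ ^ 2)⁻¹) ^ 4) • ((s - s') + ((π s - s) - (π s' - s'))) -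
          (-((‖s - s'‖ ^ 2)⁻¹) ^ 7 + ((‖s - s'‖ ^ 2)⁻¹) ^ 4) • (s - s') -
          ((-((‖s - s'‖ ^ 2)⁻¹) ^ 7 + ((‖s - s'‖ ^ 2)⁻¹) ^ 4) • ((π s - s) - (π s' - s')) +
            (2 * ⟪s - s', (π s - s) - (π s' - s')⟫ *
              (7 * ((‖s - s'‖ ^ 2)⁻¹) ^ 8 - 4 * ((‖s - s'‖ ^ 2)⁻¹) ^ 5)) • (s - s'))) := by
    -- the full matched sum is −Rest by force balance
    have hfull : ∑ s' ∈ SR.erase s,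
        (-((‖(s - s') + ((π s - s) - (π s' - s'))‖ ^ 2)⁻¹) ^ 7 +
          ((‖(s - s') + ((π s - s) - (π s' - s'))‖ ^ 2)⁻¹) ^ 4) • ((s - s') + ((π s - s) - (π s' - s'))) =
        -∑ q ∈ Rest, (deriv lennardJones (dist (π s) q) / dist (π s) q) • (π s - q) := by
      rw [← Finset.sum_congr rfl hterm, eq_neg_iff_add_eq_zero, add_comm]
      exact hsplit
    rw [Finset.sum_sub_distrib, Finset.sum_sub_distrib, hfull]
    abel
  rw [hkey, norm_neg]
  refine (norm_sum_le _ _).trans ?_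
  rw [Finset.mul_sum]
  exact Finset.sum_le_sum hrem

/-- **Linearised equation with the sharp (difference-quadratic) remainder.** Same statement as
`norm_linearised_equation_le`, with the nonlinear remainder bounded by
`6000 Σ_{s'} |s − s'|⁻⁹ ‖(π s − s) − (π s' − s')‖²` — quadratic in the DIFFERENCES of the displacement, which is
what the energy route feeds back through the Caccioppoli levels (evidence v4/v5, item (NL)). [folklore] -/
theorem norm_linearised_equation_le' (hA : Adm₀ A) (hI : Inner₀ t A) (hX : X.Finite)
    (hπ : ∀ s' ∈ Sites₀ t A, dist s' c ≤ r → π s' ∈ X ∧ dist (π s') s' ≤ ε)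
    (hinj : ∀ s₁ ∈ Sites₀ t A, ∀ s₂ ∈ Sites₀ t A, dist s₁ c ≤ r → dist s₂ c ≤ r → π s₁ = π s₂ → s₁ = s₂)
    (hε : ε ≤ 1 / 20) {s : EuclideanSpace ℝ (Fin 3)} (hs : s ∈ Sites₀ t A) (hsc : dist s c ≤ r)
    (SR : Finset (EuclideanSpace ℝ (Fin 3))) (hSR : ∀ x, x ∈ SR ↔ x ∈ Sites₀ t A ∧ dist x c ≤ r)
    (hEq : HasSum (fun q : {q : EuclideanSpace ℝ (Fin 3) // q ∈ X ∧ q ≠ π s} =>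
      (deriv lennardJones (dist (π s) q) / dist (π s) q) • (π s - (q : EuclideanSpace ℝ (Fin 3)))) 0) :
    ‖(∑ s' ∈ SR.erase s, (-((‖s - s'‖ ^ 2)⁻¹) ^ 7 + ((‖s - s'‖ ^ 2)⁻¹) ^ 4) • (s - s')) +
        (∑ s' ∈ SR.erase s,
          ((-((‖s - s'‖ ^ 2)⁻¹) ^ 7 + ((‖s - s'‖ ^ 2)⁻¹) ^ 4) • ((π s - s) - (π s' - s')) +
            (2 * ⟪s - s', (π s - s) - (π s' - s')⟫ *
              (7 * ((‖s - s'‖ ^ 2)⁻¹) ^ 8 - 4 * ((‖s - s'‖ ^ 2)⁻¹) ^ 5)) • (s - s'))) +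
        ∑ q ∈ (hX.toFinset.erase (π s)) \ ((SR.erase s).image π),
          (deriv lennardJones (dist (π s) q) / dist (π s) q) • (π s - q)‖ ≤
      6000 * ∑ s' ∈ SR.erase s, (‖s - s'‖⁻¹) ^ 9 * ‖(π s - s) - (π s' - s')‖ ^ 2 := by
  classical
  set Rest := (hX.toFinset.erase (π s)) \ ((SR.erase s).image π) with hRest
  have hε0 : 0 ≤ ε := by
    have := (hπ s hs hsc).2
    exact le_trans dist_nonneg this
  have hu : ∀ s' ∈ SR, ‖π s' - s'‖ ≤ ε := fun s' hs' => by
    rw [← dist_eq_norm]; exact (hπ s' ((hSR s').1 hs').1 ((hSR s').1 hs').2).2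
  have hsSR : s ∈ SR := (hSR s).2 ⟨hs, hsc⟩
  have hsub : (SR.erase s).image π ⊆ hX.toFinset.erase (π s) := by
    intro q hq
    rw [Finset.mem_image] at hq
    obtain ⟨s', hs', rfl⟩ := hq
    rw [Finset.mem_erase] at hs' ⊢
    obtain ⟨hne, hs'SR⟩ := hs'
    obtain ⟨hs'S, hs'c⟩ := (hSR s').1 hs'SR
    refine ⟨fun h => hne (hinj s' hs'S s hs hs'c hsc h), ?_⟩
    rw [Set.Finite.mem_toFinset]
    exact (hπ s' hs'S hs'c).1
  have hinjOn : Set.InjOn π (SR.erase s : Finset (EuclideanSpace ℝ (Fin 3))) := by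
    intro s₁ hs₁ s₂ hs₂ h
    have h1 := (hSR s₁).1 (Finset.mem_erase.1 hs₁).2
    have h2 := (hSR s₂).1 (Finset.mem_erase.1 hs₂).2
    exact hinj s₁ h1.1 s₂ h2.1 h1.2 h2.2 h
  have hbal := sum_erase_eq_zero_of_hasSum hX hEq
  have hsplit := Finset.sum_sdiff hsub
    (f := fun q => (deriv lennardJones (dist (π s) q) / dist (π s) q) • (π s - q))
  rw [hbal, Finset.sum_image hinjOn] at hsplit
  have hterm : ∀ s' ∈ SR.erase s,
      (deriv lennardJones (dist (π s) (π s')) / dist (π s) (π s')) • (π s - π s') =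
        (-((‖(s - s') + ((π s - s) - (π s' - s'))‖ ^ 2)⁻¹) ^ 7 +
          ((‖(s - s') + ((π s - s) - (π s' - s'))‖ ^ 2)⁻¹) ^ 4) • ((s - s') + ((π s - s) - (π s' - s'))) := by
    intro s' hs'
    obtain ⟨hne, hs'SR⟩ := Finset.mem_erase.1 hs'
    obtain ⟨hs'S, hs'c⟩ := (hSR s').1 hs'SR
    have hpp : π s ≠ π s' := fun h => hne (hinj s' hs'S s hs hs'c hsc h.symm)
    have hvec : π s - π s' = (s - s') + ((π s - s) - (π s' - s')) := by abel
    rw [dist_eq_norm, ljForce_eq_smul (sub_ne_zero.2 hpp), hvec]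
  have hrem : ∀ s' ∈ SR.erase s,
      ‖(-((‖(s - s') + ((π s - s) - (π s' - s'))‖ ^ 2)⁻¹) ^ 7 +
          ((‖(s - s') + ((π s - s) - (π s' - s'))‖ ^ 2)⁻¹) ^ 4) • ((s - s') + ((π s - s) - (π s' - s'))) -
        (-((‖s - s'‖ ^ 2)⁻¹) ^ 7 + ((‖s - s'‖ ^ 2)⁻¹) ^ 4) • (s - s') -
        ((-((‖s - s'‖ ^ 2)⁻¹) ^ 7 + ((‖s - s'‖ ^ 2)⁻¹) ^ 4) • ((π s - s) - (π s' - s')) +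
          (2 * ⟪s - s', (π s - s) - (π s' - s')⟫ *
            (7 * ((‖s - s'‖ ^ 2)⁻¹) ^ 8 - 4 * ((‖s - s'‖ ^ 2)⁻¹) ^ 5)) • (s - s'))‖ ≤
        6000 * ((‖s - s'‖⁻¹) ^ 9 * ‖(π s - s) - (π s' - s')‖ ^ 2) := by
    intro s' hs'
    obtain ⟨hne, hs'SR⟩ := Finset.mem_erase.1 hs'
    obtain ⟨hs'S, hs'c⟩ := (hSR s').1 hs'SR
    have he : 9 / 10 ≤ ‖s - s'‖ := by
      rw [← dist_eq_norm]
      linarith [dist_sites_ge hA hI hs hs'S (Ne.symm hne)]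
    have hw : ‖(π s - s) - (π s' - s')‖ ≤ 2 * ε := by
      calc ‖(π s - s) - (π s' - s')‖ ≤ ‖π s - s‖ + ‖π s' - s'‖ := norm_sub_le _ _
        _ ≤ ε + ε := add_le_add (hu s hsSR) (hu s' hs'SR)
        _ = 2 * ε := by ring
    have hw' : ‖(π s - s) - (π s' - s')‖ ≤ 1 / 10 := by linarith
    have h := norm_ljForce_linearisation_le he hw'
    refine h.trans (le_of_eq ?_)
    ring
  have hkey : (∑ s' ∈ SR.erase s, (-((‖s - s'‖ ^ 2)⁻¹) ^ 7 + ((‖s - s'‖ ^ 2)⁻¹) ^ 4) • (s - s')) +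
      (∑ s' ∈ SR.erase s,
        ((-((‖s - s'‖ ^ 2)⁻¹) ^ 7 + ((‖s - s'‖ ^ 2)⁻¹) ^ 4) • ((π s - s) - (π s' - s')) +
          (2 * ⟪s - s', (π s - s) - (π s' - s')⟫ *
            (7 * ((‖s - s'‖ ^ 2)⁻¹) ^ 8 - 4 * ((‖s - s'‖ ^ 2)⁻¹) ^ 5)) • (s - s'))) +
      ∑ q ∈ Rest, (deriv lennardJones (dist (π s) q) / dist (π s) q) • (π s - q) =
      -∑ s' ∈ SR.erase s,
        ((-((‖(s - s') + ((π s - s) - (π s' - s'))‖ ^ 2)⁻¹) ^ 7 +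
            ((‖(s - s') + ((π s - s) - (π s' - s'))‖ ^ 2)⁻¹) ^ 4) • ((s - s') + ((π s - s) - (π s' - s'))) -
          (-((‖s - s'‖ ^ 2)⁻¹) ^ 7 + ((‖s - s'‖ ^ 2)⁻¹) ^ 4) • (s - s') -
          ((-((‖s - s'‖ ^ 2)⁻¹) ^ 7 + ((‖s - s'‖ ^ 2)⁻¹) ^ 4) • ((π s - s) - (π s' - s')) +
            (2 * ⟪s - s', (π s - s) - (π s' - s')⟫ *
              (7 * ((‖s - s'‖ ^ 2)⁻¹) ^ 8 - 4 * ((‖s - s'‖ ^ 2)⁻¹) ^ 5)) • (s - s'))) := by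
    have hfull : ∑ s' ∈ SR.erase s,
        (-((‖(s - s') + ((π s - s) - (π s' - s'))‖ ^ 2)⁻¹) ^ 7 +
          ((‖(s - s') + ((π s - s) - (π s' - s'))‖ ^ 2)⁻¹) ^ 4) • ((s - s') + ((π s - s) - (π s' - s'))) =
        -∑ q ∈ Rest, (deriv lennardJones (dist (π s) q) / dist (π s) q) • (π s - q) := by
      rw [← Finset.sum_congr rfl hterm, eq_neg_iff_add_eq_zero, add_comm]
      exact hsplit
    rw [Finset.sum_sub_distrib, Finset.sum_sub_distrib, hfull]
    abel
  rw [hkey, norm_neg]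
  refine (norm_sum_le _ _).trans ?_
  rw [Finset.mul_sum]
  exact Finset.sum_le_sum hrem

end

end Summit.AtomisticToContinuum.Crystallization.Theorems.ExcessDecayLiouville

end
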